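import Summits.RiemannHypothesis.RiemannHypothesis.Theses.RuelleBand
import Summits.RiemannHypothesis.RiemannHypothesis.Theorems.CofiniteCriticalLine.Negative.Reformulations

/-!
# `CofiniteCriticalLine` (crux stmt-RiemannHypothesis-2064, route `RuelleBand`): the FAR / NEAR split

Strategist's file (crux-strategist, wall-breaker pass on the exhausted chain of rung #5).  The crux
("FIN") is `{s | ζ s = 0 ∧ 0 < Re s ∧ Re s < 1 ∧ Re s ≠ 1/2}.Finite`.  Read along `|Im ρ| → ∞` an infinite
family of off-line zeros either keeps a positive distance from the critical line infinitely often (it is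
FAR: this is excluded by the route's rung #4 `AsymptoticCriticalLine`) or approaches the line (it is NEAR:
it enters every collar `0 < |Re s − 1/2| < ε` above every height).  This file lands the kernel-checked
bookkeeping of that dichotomy, with every statement written out over Mathlib's `riemannZeta`
(no new definitions):

* `near_of_cofiniteCriticalLine` — FIN gives the NEAR statement
  `∃ ε > 0, ∃ T, ∀ zeros s of the open strip with T ≤ |Im s|, |Re s − 1/2| < ε → Re s = 1/2`
  ("eventually the collar of width `ε` is clean"), for free (`ε := 1`);
* `cofiniteCriticalLine_of_asymptotic_of_near` — THE GLUE: rung #4 and NEAR give FIN (the far zeros at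
  level `ε` are finitely many, hence of bounded height; above that height and above `T` every zero is
  near, hence on the line; `Negative.cofiniteCriticalLine_iff_eventually_on_line` finishes);
* `cofiniteCriticalLine_iff_asymptotic_and_near` — THE SPLIT IS LOSSLESS: FIN ↔ #4 ∧ NEAR;
* `asymptoticToCofinite_of_near` — the route's glue item `AsymptoticToCofinite` (stmt-RiemannHypothesis-14745,
  `#4 → #5`) is implied by NEAR alone: NEAR is the exact residual of rung #5 over rung #4;
* `not_abstract_near_imp_cofinite`, `not_abstract_asymptotic_imp_near`, `not_abstract_near_imp_asymptotic`
  — SHAPE INDEPENDENCE on abstract point sets: NEAR-shape does not give FIN-shape (witness `3/4 + n i`),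
  #4-shape does not give NEAR-shape (witness `1/2 + 1/(n+2) + n i`, the model of
  `Negative.not_abstract_asymptotic_imp_cofinite`), NEAR-shape does not give #4-shape (`3/4 + n i` again):
  neither conjunct is the crux reworded and neither implies the other formally.

Both conjuncts are RH-implied OPEN problems; nothing here claims either.  NEAR is "RH in a collar of
fixed width, above some height"; the crux directory's obstruction notes (B4 UniversalTubeScale, B18,
Disproof §7–§8) record that no mechanism for it is known — this file only certifies that it is exactly
what rung #5 adds to rung #4.
-/

noncomputable section

namespace Summit.RiemannHypothesis.RiemannHypothesis.Theorems.CofiniteCriticalLine.NearFarSplit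

open Complex Set
open Summit.RiemannHypothesis.RiemannHypothesis.Theses.RuelleBand (CofiniteCriticalLine
  AsymptoticCriticalLine AsymptoticToCofinite)
open Summit.RiemannHypothesis.Cruxes.CofiniteCriticalLine.Negative
  (cofiniteCriticalLine_iff_eventually_on_line not_riemannHypothesis_of_not_cofiniteCriticalLine)

/-! ## FIN gives NEAR for free -/

/-- FIN ⟹ NEAR: above the (finitely many) exceptional zeros every zero of the open strip is on the line,
so in particular every zero in any collar is (take `ε := 1`). [folklore] -/
theorem near_of_cofiniteCriticalLine (h : CofiniteCriticalLine) :
    ∃ ε : ℝ, 0 < ε ∧ ∃ T : ℝ, ∀ s : ℂ, riemannZeta s = 0 → 0 < s.re → s.re < 1 → T ≤ |s.im| →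
      |s.re - 1 / 2| < ε → s.re = 1 / 2 := by
  obtain ⟨T, hT⟩ := cofiniteCriticalLine_iff_eventually_on_line.1 h
  exact ⟨1, one_pos, T + 1, fun s hz h0 h1 hT' _ => hT s hz h0 h1 (by linarith)⟩

/-! ## The glue: rung #4 and NEAR give FIN -/

/-- **GLUE (far ∧ near ⟹ cofinite).** If for every `ε > 0` only finitely many zeros of the open strip lie
at distance `≥ ε` from the critical line (rung #4, `AsymptoticCriticalLine`) and some collar
`|Re s − 1/2| < ε` is free of off-line zeros above some height (NEAR), then only finitely many zeros of the
open strip are off the line: the level-`ε` far set is finite, hence of bounded height `T₂`; a zero above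
`max T T₂` is near, hence on the line; conclude by `cofiniteCriticalLine_iff_eventually_on_line`.
[folklore] -/
theorem cofiniteCriticalLine_of_asymptotic_of_near (h4 : AsymptoticCriticalLine)
    (hN : ∃ ε : ℝ, 0 < ε ∧ ∃ T : ℝ, ∀ s : ℂ, riemannZeta s = 0 → 0 < s.re → s.re < 1 → T ≤ |s.im| →
      |s.re - 1 / 2| < ε → s.re = 1 / 2) :
    CofiniteCriticalLine := by
  obtain ⟨ε, hε, T, hT⟩ := hN
  have hfar := h4 ε hε
  obtain ⟨T₂, hT₂⟩ := (hfar.image fun s : ℂ => |s.im|).bddAbove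
  refine cofiniteCriticalLine_iff_eventually_on_line.2 ⟨max T T₂, fun s hz h0 h1 hs => ?_⟩
  by_cases hnear : |s.re - 1 / 2| < ε
  · exact hT s hz h0 h1 (le_trans (le_max_left _ _) hs.le) hnear
  · have hmem : |s.im| ∈ (fun s : ℂ => |s.im|) '' {s : ℂ | riemannZeta s = 0 ∧ 0 < s.re ∧ s.re < 1 ∧
        ε ≤ |s.re - 1 / 2|} := ⟨s, ⟨hz, h0, h1, not_lt.1 hnear⟩, rfl⟩
    have hle : |s.im| ≤ T₂ := hT₂ hmem
    exact absurd (lt_of_le_of_lt (le_max_right T T₂) hs) (not_lt.2 hle)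

/-- **THE SPLIT IS LOSSLESS.** FIN ↔ (rung #4) ∧ NEAR.  `→`: `LadderGlue`'s second half
(`Set.Finite.subset`) and `near_of_cofiniteCriticalLine`; `←`: the glue above. [folklore] -/
theorem cofiniteCriticalLine_iff_asymptotic_and_near :
    CofiniteCriticalLine ↔
      AsymptoticCriticalLine ∧
        ∃ ε : ℝ, 0 < ε ∧ ∃ T : ℝ, ∀ s : ℂ, riemannZeta s = 0 → 0 < s.re → s.re < 1 → T ≤ |s.im| →
          |s.re - 1 / 2| < ε → s.re = 1 / 2 := by
  constructor
  · intro h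
    refine ⟨fun ε hε => h.subset ?_, near_of_cofiniteCriticalLine h⟩
    rintro s ⟨hz, h0, h1, hε'⟩
    refine ⟨hz, h0, h1, fun heq => ?_⟩
    rw [heq, sub_self, abs_zero] at hε'
    linarith
  · rintro ⟨h4, hN⟩
    exact cofiniteCriticalLine_of_asymptotic_of_near h4 hN

/-- NEAR alone implies the route's glue item `AsymptoticToCofinite` (stmt-RiemannHypothesis-14745, `#4 → #5`):
NEAR is the exact residual of rung #5 over rung #4. [folklore] -/
theorem asymptoticToCofinite_of_near
    (hN : ∃ ε : ℝ, 0 < ε ∧ ∃ T : ℝ, ∀ s : ℂ, riemannZeta s = 0 → 0 < s.re → s.re < 1 → T ≤ |s.im| →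
      |s.re - 1 / 2| < ε → s.re = 1 / 2) :
    AsymptoticToCofinite :=
  fun h4 => cofiniteCriticalLine_of_asymptotic_of_near h4 hN

/-- Under RH the NEAR statement holds (every zero of the open strip is on the line). [folklore] -/
theorem near_of_riemannHypothesis (h : RiemannHypothesis) :
    ∃ ε : ℝ, 0 < ε ∧ ∃ T : ℝ, ∀ s : ℂ, riemannZeta s = 0 → 0 < s.re → s.re < 1 → T ≤ |s.im| →
      |s.re - 1 / 2| < ε → s.re = 1 / 2 :=
  near_of_cofiniteCriticalLine
    (Classical.by_contradiction fun hc => not_riemannHypothesis_of_not_cofiniteCriticalLine hc h)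

/-! ## Shape independence on abstract point sets -/

/-- NEAR-shape does not give FIN-shape for an abstract set `Z ⊆ ℂ`: `Z = {3/4 + n i}` has a clean collar of
width `1/8` (vacuously: all its points are at distance `1/4` from the line) and infinitely many off-line
points.  So NEAR is not the crux reworded. [folklore] -/
theorem not_abstract_near_imp_cofinite :
    ¬ ∀ Z : Set ℂ, (∃ ε : ℝ, 0 < ε ∧ ∃ T : ℝ, ∀ s ∈ Z, T ≤ |s.im| → |s.re - 1 / 2| < ε → s.re = 1 / 2) →
      {s ∈ Z | s.re ≠ 1 / 2}.Finite := by
  intro h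
  let f : ℕ → ℂ := fun n => ((3 / 4 : ℝ) : ℂ) + (n : ℂ) * I
  have hf_re : ∀ n, (f n).re = 3 / 4 := by intro n; simp [f]
  have hf_im : ∀ n, (f n).im = n := by intro n; simp [f]
  have hf : Function.Injective f := by
    intro a b hab
    have := congrArg Complex.im hab
    rw [hf_im, hf_im] at this
    exact_mod_cast this
  have hnear : ∃ ε : ℝ, 0 < ε ∧ ∃ T : ℝ, ∀ s ∈ Set.range f, T ≤ |s.im| → |s.re - 1 / 2| < ε →
      s.re = 1 / 2 := by
    refine ⟨1 / 8, by norm_num, 0, ?_⟩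
    rintro s ⟨n, rfl⟩ _ hlt
    rw [hf_re] at hlt
    norm_num [abs_of_pos] at hlt
  have hfin := h (Set.range f) hnear
  refine (Set.infinite_range_of_injective hf) (hfin.subset ?_)
  rintro s ⟨n, rfl⟩
  refine ⟨⟨n, rfl⟩, ?_⟩
  show (f n).re ≠ 1 / 2
  rw [hf_re]; norm_num

/-- NEAR-shape does not give #4-shape either (same witness `3/4 + n i`: infinitely many points at distance
`1/4 ≥ ε := 1/8` from the line). [folklore] -/
theorem not_abstract_near_imp_asymptotic :
    ¬ ∀ Z : Set ℂ, (∃ ε : ℝ, 0 < ε ∧ ∃ T : ℝ, ∀ s ∈ Z, T ≤ |s.im| → |s.re - 1 / 2| < ε → s.re = 1 / 2) →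
      ∀ ε : ℝ, 0 < ε → {s ∈ Z | ε ≤ |s.re - 1 / 2|}.Finite := by
  intro h
  let f : ℕ → ℂ := fun n => ((3 / 4 : ℝ) : ℂ) + (n : ℂ) * I
  have hf_re : ∀ n, (f n).re = 3 / 4 := by intro n; simp [f]
  have hf_im : ∀ n, (f n).im = n := by intro n; simp [f]
  have hf : Function.Injective f := by
    intro a b hab
    have := congrArg Complex.im hab
    rw [hf_im, hf_im] at this
    exact_mod_cast this
  have hnear : ∃ ε : ℝ, 0 < ε ∧ ∃ T : ℝ, ∀ s ∈ Set.range f, T ≤ |s.im| → |s.re - 1 / 2| < ε →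
      s.re = 1 / 2 := by
    refine ⟨1 / 8, by norm_num, 0, ?_⟩
    rintro s ⟨n, rfl⟩ _ hlt
    rw [hf_re] at hlt
    norm_num [abs_of_pos] at hlt
  have hfin := h (Set.range f) hnear (1 / 8) (by norm_num)
  refine (Set.infinite_range_of_injective hf) (hfin.subset ?_)
  rintro s ⟨n, rfl⟩
  refine ⟨⟨n, rfl⟩, ?_⟩
  show (1 / 8 : ℝ) ≤ |(f n).re - 1 / 2|
  rw [hf_re]; norm_num [abs_of_pos]

/-- #4-shape does not give NEAR-shape for an abstract set: `Z = {1/2 + 1/(n+2) + n i}` (the model of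
`Negative.not_abstract_asymptotic_imp_cofinite`) meets every band `|Re s − 1/2| ≥ ε > 0` in finitely many
points, yet every collar of every width contains off-line points of `Z` at arbitrarily large height.  So the
FAR conjunct does not subsume the NEAR one formally. [folklore] -/
theorem not_abstract_asymptotic_imp_near :
    ¬ ∀ Z : Set ℂ, (∀ ε : ℝ, 0 < ε → {s ∈ Z | ε ≤ |s.re - 1 / 2|}.Finite) →
      ∃ ε : ℝ, 0 < ε ∧ ∃ T : ℝ, ∀ s ∈ Z, T ≤ |s.im| → |s.re - 1 / 2| < ε → s.re = 1 / 2 := by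
  intro h
  let f : ℕ → ℂ := fun n => ((1 / 2 + 1 / ((n : ℝ) + 2) : ℝ) : ℂ) + (n : ℂ) * I
  have hf_re : ∀ n, (f n).re = 1 / 2 + 1 / ((n : ℝ) + 2) := by
    intro n
    simp only [f, add_re, ofReal_re, mul_re, natCast_re, natCast_im, I_re, I_im, mul_zero, zero_mul,
      sub_zero, add_zero]
  have hf_im : ∀ n, (f n).im = n := by
    intro n
    simp only [f, add_im, ofReal_im, mul_im, natCast_re, natCast_im, I_re, I_im, mul_one, mul_zero,
      add_zero, zero_add]
  have hpos : ∀ n : ℕ, (0 : ℝ) < 1 / ((n : ℝ) + 2) := fun n => by positivity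
  have hband : ∀ ε : ℝ, 0 < ε → {s ∈ Set.range f | ε ≤ |s.re - 1 / 2|}.Finite := by
    intro ε hε
    refine ((Set.finite_Iic ⌈1 / ε⌉₊).image f).subset ?_
    rintro s ⟨⟨n, rfl⟩, hs⟩
    refine ⟨n, ?_, rfl⟩
    rw [hf_re, add_sub_cancel_left, abs_of_pos (hpos n)] at hs
    show n ≤ ⌈1 / ε⌉₊
    have hn2 : (0 : ℝ) < (n : ℝ) + 2 := by positivity
    have h1 : ε * ((n : ℝ) + 2) ≤ 1 := by
      have := (le_div_iff₀ hn2).1 hs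
      linarith
    have h2 : (n : ℝ) + 2 ≤ 1 / ε := by
      rw [le_div_iff₀ hε]; linarith
    have h3 : (n : ℝ) ≤ ⌈1 / ε⌉₊ := by linarith [Nat.le_ceil (1 / ε)]
    exact_mod_cast h3
  obtain ⟨ε, hε, T, hT⟩ := h (Set.range f) hband
  -- pick `n` with `T ≤ n` and `1/(n+2) < ε`: the point `f n` is in the collar above height `T`, off the line
  obtain ⟨n, hn⟩ := exists_nat_gt (max T (1 / ε))
  have hnT : T ≤ (n : ℝ) := ((le_max_left _ _).trans hn.le)
  have hnε : 1 / ((n : ℝ) + 2) < ε := by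
    have hε' : 1 / ε < (n : ℝ) + 2 := by linarith [(le_max_right T (1 / ε)).trans hn.le]
    have hn2 : (0 : ℝ) < (n : ℝ) + 2 := by positivity
    rw [div_lt_iff₀ hn2]
    have := (div_lt_iff₀ hε).1 hε'
    linarith
  have hcollar : |(f n).re - 1 / 2| < ε := by
    rw [hf_re, add_sub_cancel_left, abs_of_pos (hpos n)]
    exact hnε
  have him : T ≤ |(f n).im| := by
    rw [hf_im, abs_of_nonneg (Nat.cast_nonneg n)]
    exact hnT
  have := hT (f n) ⟨n, rfl⟩ him hcollar
  rw [hf_re] at this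
  linarith [hpos n]

end Summit.RiemannHypothesis.RiemannHypothesis.Theorems.CofiniteCriticalLine.NearFarSplit

end
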